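import Literature.NumberTheory.GelbartRogawski1991.LocalScaleModelTransport
import Literature.NumberTheory.Automorphic.UnitaryGroupFinAdelicCenterLocal
import Literature.RepresentationTheory.TwistedCoinvariants
import HarnessLib

/-!
# The scale transport descends to the coinvariants: `Θ_ξ(ω^{T} ∘ scaleTransport_a(s′)) = Θ_ξ(ω^{aT} ∘ s′) ∘ scaleInl`

Topic `NumberTheory/GelbartRogawski1991`; namespaces `Literature.RepresentationTheory.TwistedCoinv` (§1, generic) and
`Literature.NumberTheory.GelbartRogawski1991.UnitaryDualPair.LocalSplitting` (§2–§3).  KERNEL ONLY: theorems; no definition, no named fact, no `sorry`.  Cell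
`hodgecm-mathlib` (D-0151), programme P5 (crux HLiu418 = stmt-HodgeConjecture-24832), piece **(C4a)** of the road card `F0/P5/A-p18/g23/ROAD-L4if-v3.A-p18g23.md` §6
(A-p18 (g23), 2026-09-01): reading the transported objects of ★ (C1)-rep ∕ (C3)-rep ∕ (C4)-core on the MEMBERS' OWN models.

★ `omega_scaleTransportSection` ([MoeglinVignerasWaldspurger1987, Chap. 2 II.1; Chap. 3 I.1]): `ω^{T} ∘ scaleTransportSection_a(s′) = (ω^{aT} ∘ s′) ∘ scaleInl` AS
REPRESENTATIONS (same operators; `scaleInl : U(J)(F_v) →* U(aJ)(F_v)` the identity on matrices).  Hence, for the centre `Z = U(J₁)(F_v)` (`scaleInl ∘ localCenter_J =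
localCenter_{aJ}`, `scaleInl_localCenter`) and ANY character `ξ` of `Z`:
* §1 generic `TwistedCoinv.exists_equiv_of_comp_two_groups`: a pull-back `ρ₂ = ρ₁ ∘ κ` along `κ : G →* G′` with `κ ∘ ι = ι′` has the SAME relation submodule, so the identity on
  classes is `(ρ₂)_{H,χ} ≃ (ρ₁)_{H,χ}` intertwining `rep χ ρ₂ (g)` with `rep χ ρ₁ (κ g)`;
* §3 **`exists_coinv_equiv_scaleTransportSection`**: `∃ e : (ω^{T} ∘ scaleT_a s′)_{Z,ξ} ≃ (ω^{aT} ∘ s′)_{Z,ξ}` with `e ∘ rep(g) = rep(scaleInl g) ∘ e` — for ANY section `s′` over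
  `ι^{aT}_δ` ([Liu2021, App. D §D.1 Step 3]: theta-type representations as coinvariants under the centre).
Nothing of the cited sources is asserted; HC_CM is proved only modulo the printed citations until rung 0 closes.

## References
* [MoeglinVignerasWaldspurger1987] LNM 1291 (1987), Chap. 2 II.1–II.2; Chap. 3 I.1.
* [GelbartRogawski1991] S. Gelbart, J. Rogawski, Invent. Math. 105 (1991), §3.1 p. 454, Remark p. 457 L4–13.
* [Liu2021] Y. Liu, App. D §D.1 Step 3 (l. 5221).
-/

set_option autoImplicit false

noncomputable section

open NumberField IsDedekindDomain Matrix
open Literature.RepresentationTheory.HeisenbergGroup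
open Literature.NumberTheory.Automorphic Literature.NumberTheory.Automorphic.UnitaryGroup Literature.NumberTheory.Weil1964

/-! ## §1 Generic: pull-back along a homomorphism of groups compatible with the centres -/

namespace Literature.RepresentationTheory.TwistedCoinv

variable {k : Type*} [CommRing k] {G G' H S : Type*} [Group G] [Group G'] [Group H] [AddCommGroup S] [Module k S]

/-- **Transport of coinvariants along a pull-back between two groups.**  `ρ₂ = ρ₁ ∘ κ` for `κ : G →* G′` with `κ ∘ ι = ι′`: the identity on classes is an isomorphism
`(ρ₂)_{H,χ} ≃ (ρ₁)_{H,χ}` (relation submodules EQUAL) intertwining `rep χ ρ₂ (g)` with `rep χ ρ₁ (κ g)`. [cite: GelbartRogawski1991, §3.1 Remark p. 457 L4–13]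
[cite: MoeglinVignerasWaldspurger1987, Chap. 2 II.2] -/
theorem exists_equiv_of_comp_two_groups (ρ₁ : Representation k G' S) (ρ₂ : Representation k G S) (κ : G →* G') (hρ : ρ₂ = ρ₁.comp κ)
    (ι : H →* G) (ι' : H →* G') (hι : ∀ h, κ (ι h) = ι' h) (χ : H →* kˣ)
    (hc₁ : ∀ (g' : G') (h : H), Commute (ρ₁ g') ((ρ₁.comp ι') h)) (hc₂ : ∀ (g : G) (h : H), Commute (ρ₂ g) ((ρ₂.comp ι) h)) :
    ∃ e : Coinv (ρ₂.comp ι) χ ≃ₗ[k] Coinv (ρ₁.comp ι') χ, ∀ (g : G) (x : Coinv (ρ₂.comp ι) χ), e (rep χ ρ₂ hc₂ g x) = rep χ ρ₁ hc₁ (κ g) (e x) := by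
  have hW : ρ₂.comp ι = ρ₁.comp ι' := MonoidHom.ext fun h => by rw [MonoidHom.comp_apply, MonoidHom.comp_apply, hρ, MonoidHom.comp_apply, hι]
  refine ⟨Submodule.quotEquivOfEq _ _ (by rw [hW]), fun g x => ?_⟩
  obtain ⟨w, rfl⟩ := mk_surjective _ _ x
  rw [rep_mk, mk_apply, mk_apply, Submodule.quotEquivOfEq_mk, Submodule.quotEquivOfEq_mk, hρ, MonoidHom.comp_apply]
  rfl

end Literature.RepresentationTheory.TwistedCoinv

open Literature.RepresentationTheory.TwistedCoinv

namespace Literature.NumberTheory.GelbartRogawski1991.UnitaryDualPair.LocalSplitting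

/-! ## §2 `scaleInl` fixes the centre embedding -/

section Centre

variable (F E : Type) [Field F] [NumberField F] [Field E] [NumberField E] [Algebra F E] (c : E ≃ₐ[F] E) (N : ℕ)
  (T T' : Matrix (Fin N) (Fin N) F) (a : Fˣ) (hTT' : T' = (a : F) • T)
  {J J' : Matrix (Fin N) (Fin N) E} (hJ : J = T.map (algebraMap F E)) (hJ' : J' = T'.map (algebraMap F E))
  {J₁ : Matrix (Fin 1) (Fin 1) E} (hJ₁ : J₁ 0 0 ≠ 0) (v : HeightOneSpectrum (𝓞 F))

/-- **`scaleInl (u · 1_N) = u · 1_N`**: the retyping `U(J)(F_v) →* U(aJ)(F_v)` carries the centre embedding of `J` to that of `aJ`.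
[cite: GelbartRogawski1991, §3.1 p. 454] [cite: MoeglinVignerasWaldspurger1987, Chap. 2 II.2] -/
theorem scaleInl_localCenter (u : localPi E c 1 J₁ v) :
    scaleInl F E c N T T' a hTT' hJ hJ' v (localCenter E c N J J₁ hJ₁ v u) = localCenter E c N J' J₁ hJ₁ v u :=
  Subtype.ext (by rw [coe_scaleInl, coe_localCenter, coe_localCenter])

end Centre

/-! ## §3 The coinvariants of the scale-transported section -/

section Coinv

variable (F E : Type) [Field F] [NumberField F] [Field E] [NumberField E] [Algebra F E] [Algebra.IsQuadraticExtension F E] (c : E ≃ₐ[F] E) (N : ℕ)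
  {δ : E} (hcδ : c δ = -δ) (hδ : δ ≠ 0) {d : F} (hd : δ * δ = algebraMap F E d)
  (T T' : Matrix (Fin N) (Fin N) F) (hT : T.IsSymm) (hT' : T'.IsSymm) (a : Fˣ) (hTT' : T' = (a : F) • T)
  {J J' : Matrix (Fin N) (Fin N) E} (hJ : J = T.map (algebraMap F E)) (hJ' : J' = T'.map (algebraMap F E))
  {J₁ : Matrix (Fin 1) (Fin 1) E} (hJ₁ : J₁ 0 0 ≠ 0) (v : HeightOneSpectrum (𝓞 F))

/-- **`Θ_ξ(ω^{T} ∘ scaleTransport_a(s′)) = Θ_ξ(ω^{aT} ∘ s′) ∘ scaleInl`** for ANY section `s′` of `U(aJ)(F_v)` over `ι^{aT}_δ` and any character `ξ` of the centre: the identity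
on classes is an isomorphism of the `ξ`-coinvariants intertwining `rep(g)` with `rep(scaleInl g)` (★ `omega_scaleTransportSection`).
[cite: MoeglinVignerasWaldspurger1987, Chap. 2 II.1; Chap. 3 I.1] [cite: Liu2021, App. D §D.1 Step 3 (l. 5221)] [cite: GelbartRogawski1991, §3.1 Remark p. 457 L4–13] -/
theorem exists_coinv_equiv_scaleTransportSection (s' : localPi E c N J' v →* LocalMp F N T' v)
    (hs' : ∀ g, MpPsi.proj _ (s' g) = iota F E c N hcδ hδ hd T' hT' hJ' v g) (ξ : localPi E c 1 J₁ v →* ℂˣ)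
    (hc₂ : ∀ (g : localPi E c N J v) (u : localPi E c 1 J₁ v),
      Commute (((MpPsi.toRep (localSchrodinger F N T v)).comp (scaleTransportSection F E c N hcδ hδ hd T T' hT hT' a hTT' hJ hJ' v s' hs')) g)
        ((((MpPsi.toRep (localSchrodinger F N T v)).comp (scaleTransportSection F E c N hcδ hδ hd T T' hT hT' a hTT' hJ hJ' v s' hs')).comp
          (localCenter E c N J J₁ hJ₁ v)) u))
    (hc₁ : ∀ (g' : localPi E c N J' v) (u : localPi E c 1 J₁ v),
      Commute (((MpPsi.toRep (localSchrodinger F N T' v)).comp s') g') ((((MpPsi.toRep (localSchrodinger F N T' v)).comp s').comp (localCenter E c N J' J₁ hJ₁ v)) u)) :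
    ∃ e : Coinv (((MpPsi.toRep (localSchrodinger F N T v)).comp (scaleTransportSection F E c N hcδ hδ hd T T' hT hT' a hTT' hJ hJ' v s' hs')).comp
          (localCenter E c N J J₁ hJ₁ v)) ξ ≃ₗ[ℂ]
        Coinv (((MpPsi.toRep (localSchrodinger F N T' v)).comp s').comp (localCenter E c N J' J₁ hJ₁ v)) ξ,
      ∀ (g : localPi E c N J v) x,
        e (rep ξ ((MpPsi.toRep (localSchrodinger F N T v)).comp (scaleTransportSection F E c N hcδ hδ hd T T' hT hT' a hTT' hJ hJ' v s' hs')) hc₂ g x) =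
          rep ξ ((MpPsi.toRep (localSchrodinger F N T' v)).comp s') hc₁ (scaleInl F E c N T T' a hTT' hJ hJ' v g) (e x) :=
  exists_equiv_of_comp_two_groups _ _ (scaleInl F E c N T T' a hTT' hJ hJ' v)
    (omega_scaleTransportSection F E c N hcδ hδ hd T T' hT hT' a hTT' hJ hJ' v s' hs') (localCenter E c N J J₁ hJ₁ v) (localCenter E c N J' J₁ hJ₁ v)
    (scaleInl_localCenter F E c N T T' a hTT' hJ hJ' hJ₁ v) ξ hc₁ hc₂

end Coinv

end Literature.NumberTheory.GelbartRogawski1991.UnitaryDualPair.LocalSplitting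

end
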